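/-
Fleet lead `ym-wcr-19609-p1` (seat prover-ym-wcr-19609-p1-g2-0), route `WeakCouplingRates`, crux `BulkDominatesColdBoxW`
(stmt-QuantumFields-19609), line `dlr-chessboard` (v8): LINEAR forest Poincaré ladder WITH EXTERIOR DATUM (input of the `goodTD` small-field sandwich).
-/
import Summits.QuantumFields.YangMills.Theorems.WeakCouplingRatesBulkDominatesColdBoxWForestPoincareDatum
import Summits.QuantumFields.YangMills.Theorems.WeakCouplingRatesColdBoxForestPoincareLinear

/-!
# Crux `BulkDominatesColdBoxW`, expansion stubs: linear forest Poincaré inequality with exterior datum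

The datum twin of `abs_dirGlue_le_of_sCirc_le` (`…ColdBoxForestPoincareLinear`, flat): for a real edge function `A` on `ℤ⁴` with `|A_e| ≤ r` off the
cold box `Λ = boxEdges 4 (2H+1)`, `A = 0` on the temporal forest, and all linear circulations `|sCirc A (x;i,j)| ≤ M`, EVERY edge value satisfies
`|A_e| ≤ (12H²+2H+1)(M + 4r)` (`abs_le_of_sCirc_le_of_exterior_le`) — `ell_le_uniform_of_exterior_le` (M2, `…ForestPoincareDatum`) in the group
`Multiplicative ℝ` with the length `|toAdd ·|`.  This is the link-smallness step of the `goodTD` sandwich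
(`{∀ p c, |√(2β)F̄_c(p) + dirCirc H p (t c)| ≤ R} ⊆ goodTD`, datum twin of `smallField_subset_goodT`) applied to `A = glue ϑ'_c (mean ϑ'_c + t_c)`.
No new definition; standard axioms.  NOT a claim about the mass gap.
-/

set_option autoImplicit false

noncomputable section

open Literature.Probability.LatticeModels Literature.MathematicalPhysics.QuantumLattice
open Literature.MathematicalPhysics.QuantumFieldTheory Literature.MathematicalPhysics.QuantumFieldTheory.AxialGauge
open Literature.MathematicalPhysics.QuantumFieldTheory.LatticeMaxwell

namespace Summit.QuantumFields.YangMills.Theorems.WeakCouplingRates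

variable {H : ℕ}

/-- **Linear forest Poincaré inequality with exterior datum**: `|A_e| ≤ (12H²+2H+1)(M + 4r)` for every edge, if `|A| ≤ r` off the cold box, `A = 0`
on the temporal forest and all linear circulations are `≤ M` in absolute value (`H ≥ 1`, `r ≥ 0`). -/
theorem abs_le_of_sCirc_le_of_exterior_le (hH : 1 ≤ H) (A : Literature.MathematicalPhysics.QuantumLattice.ZdEdge 4 → ℝ) {M r : ℝ} (hr : 0 ≤ r)
    (hout : ∀ e, e ∉ boxEdges 4 (2 * H + 1) → |A e| ≤ r)
    (hforest : ∀ x : Site 4, (∀ k : Fin 4, 1 ≤ x k ∧ x k + 1 ≤ 2 * (H : ℤ)) → A (x, 0) = 0)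
    (hM : ∀ (x : Site 4) (i j : Fin 4), |sCirc A (x, i, j)| ≤ M)
    (e : Literature.MathematicalPhysics.QuantumLattice.ZdEdge 4) :
    |A e| ≤ (12 * (H : ℝ) ^ 2 + 2 * H + 1) * (M + 4 * r) := by
  set V : LGConfig 4 (Multiplicative ℝ) := fun e => Multiplicative.ofAdd (A e) with hV
  have h := ell_le_uniform_of_exterior_le (H := H) (fun g : Multiplicative ℝ => |Multiplicative.toAdd g|) (by simp)
    (fun x y => by simpa [toAdd_mul] using abs_add_le (Multiplicative.toAdd x) (Multiplicative.toAdd y))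
    (fun x => by simp [toAdd_inv, abs_neg])
    (fun x g => by simp)
    V (r := r) (M := M)
    (fun e he => by simpa [hV] using hout e he)
    (fun x hx => by simp only [hV, hforest x hx]; rfl)
    (fun x i j => by rw [hV, toAdd_plaquetteHolonomyZd_ofAdd]; exact hM x i j) hH hr e
  simpa [hV] using h

end Summit.QuantumFields.YangMills.Theorems.WeakCouplingRates

end
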